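import Mathlib
import HarnessLib
import Literature.Combinatorics.SimpleGraph.WallTopologicalMinor
import Literature.Combinatorics.SimpleGraph.TreewidthBrambleLowerBound
import Summits.ValiantsHypothesis.ValiantsHypothesis.Theorems.MonotoneRestorationMonotoneRestorationQPLinearWidthTreewidthMinorMonotone

/-!
# Route MonotoneRestoration, crux `MonotoneRestorationQP` (stmt-15886), line `linear_width` —
# THE TREE-WIDTH OF THE WALL: `grid r b ≼ₘ wall r` for `2b + 1 ≤ r`, hence `tw(W_r) ≥ (r-1)/2`

Helper file (`--supports stmt-ValiantsHypothesis-15886`), def-free.  Step (P2'') of the g13 census: every wall-based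
distinguishing argument on the line (induced subdivided walls from Korhonen's theorem, normalised to induced 2-subdivisions
of subcubic bases, cf. `CFIHomMonotoneApex`) needs a LOWER bound on the tree-width of the tree's wall `wall r`
(`WallTopologicalMinor.lean`); the tree has the grid (`min_le_treewidth_grid`, brambles of crosses) and, since p841521,
minor-monotonicity (`treewidth_le_of_isMinor`).  Here:

* `grid_isMinor_wall` — the `(r+1) × (b+1)` grid is a MINOR of the `r`-wall whenever `2b + 1 ≤ r`: contract the horizontal
  pairs `{(i,2m), (i,2m+1)}` (exactly one of the two columns carries the vertical edge to the next row);
* `le_treewidth_wall` — `b ≤ tw(wall r)` for `2b + 1 ≤ r`, i.e. `tw(W_r) ≥ ⌊(r-1)/2⌋`.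

Honest label: library-type facts recorded on the line that needs them; no stub closed; θ₁, the cruxes and VP ≠ VNP NOT
moved. [cite: GalesiEtAl2023, §2 (walls); BondyMurty2008, §10.5; Diestel2010, §12.3]
-/

set_option linter.dupNamespace false

noncomputable section

open scoped Classical
open scoped Literature.Combinatorics.SimpleGraph

namespace Summit.ValiantsHypothesis.ValiantsHypothesis.Theorems.CFIHomMonotone

open Literature.Combinatorics.SimpleGraph (treewidth IsMinor grid wall wall_adj grid_adj)

/-- **The grid is a minor of the wall**: for `2b + 1 ≤ r`, `grid r b ≼ₘ wall r` (branch set of `(i, m)` = the horizontal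
pair `{(i, 2m), (i, 2m+1)}`). [cite: GalesiEtAl2023, §2 (walls and grids)] -/
theorem grid_isMinor_wall {r b : ℕ} (hb : 2 * b + 1 ≤ r) : grid r b ≼ₘ wall r := by
  -- the branch-set map: `(i, j) ↦ (i, j / 2)` when `j / 2 ≤ b`
  let φ : Fin (r + 1) × Fin (r + 1) → Option (Fin (r + 1) × Fin (b + 1)) := fun x =>
    if (x.2 : ℕ) / 2 ≤ b then some (x.1, ⟨(x.2 : ℕ) / 2 % (b + 1), Nat.mod_lt _ (Nat.succ_pos b)⟩) else none
  have hval : ∀ (x : Fin (r + 1) × Fin (r + 1)) (h : (x.2 : ℕ) / 2 ≤ b),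
      φ x = some (x.1, ⟨(x.2 : ℕ) / 2, Nat.lt_succ_of_le h⟩) := by
    intro x h
    simp only [φ, if_pos h, Option.some.injEq, Prod.mk.injEq, true_and]
    exact Fin.ext (Nat.mod_eq_of_lt (Nat.lt_succ_of_le h))
  have hinv : ∀ (x : Fin (r + 1) × Fin (r + 1)) (i : Fin (r + 1)) (m : Fin (b + 1)),
      φ x = some (i, m) → x.1 = i ∧ (x.2 : ℕ) / 2 = m := by
    intro x i m hx
    by_cases h : (x.2 : ℕ) / 2 ≤ b
    · rw [hval x h, Option.some.injEq, Prod.mk.injEq] at hx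
      exact ⟨hx.1, by simpa using congrArg Fin.val hx.2⟩
    · simp only [φ, if_neg h] at hx
      exact absurd hx (by simp)
  refine ⟨φ, ?_, ?_, ?_⟩
  · -- branch sets are nonempty: `(i, 2m)` lies over `(i, m)`
    rintro ⟨i, m⟩
    have hm : 2 * (m : ℕ) ≤ r := by have := m.isLt; omega
    refine ⟨(i, ⟨2 * (m : ℕ), Nat.lt_succ_of_le hm⟩), ?_⟩
    rw [hval _ (by simp; omega)]
    simp only [Option.some.injEq, Prod.mk.injEq, true_and]
    exact Fin.ext (by simp)
  · -- branch sets are connected: two columns of one pair are joined by a horizontal edge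
    intro x y hxy hx
    obtain ⟨⟨i, m⟩, hxm⟩ := Option.ne_none_iff_exists'.1 hx
    obtain ⟨hxi, hxj⟩ := hinv x i m hxm
    obtain ⟨hyi, hyj⟩ := hinv y i m (hxy ▸ hxm)
    by_cases hj : x.2 = y.2
    · have hxy' : x = y := Prod.ext (hxi.trans hyi.symm) hj
      subst hxy'
      exact ⟨SimpleGraph.Walk.nil, fun z hz => by
        rw [SimpleGraph.Walk.support_nil, List.mem_singleton] at hz
        rw [hz]⟩
    · have hadj : (wall r).Adj x y := by
        rw [wall_adj]
        refine Or.inl ⟨hxi.trans hyi.symm, ?_⟩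
        have hne : (x.2 : ℕ) ≠ y.2 := fun h => hj (Fin.ext h)
        omega
      refine ⟨SimpleGraph.Walk.cons hadj SimpleGraph.Walk.nil, fun z hz => ?_⟩
      rw [SimpleGraph.Walk.support_cons, SimpleGraph.Walk.support_nil, List.mem_cons,
        List.mem_singleton] at hz
      rcases hz with rfl | rfl
      · rfl
      · exact hxy.symm
  · -- every grid edge is realised by a wall edge between the branch sets
    rintro ⟨i, m⟩ ⟨i', m'⟩ h
    rw [grid_adj] at h
    simp only at h
    rcases h with ⟨hii', hmm' | hmm'⟩ | ⟨hmm', hii' | hii'⟩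
    · -- same row, `m' = m + 1`: columns `2m+1` and `2m+2`
      subst hii'
      have hm' : 2 * (m' : ℕ) ≤ r := by have := m'.isLt; omega
      refine ⟨(i, ⟨2 * (m : ℕ) + 1, by omega⟩), (i, ⟨2 * (m' : ℕ), by omega⟩), ?_, ?_, ?_⟩
      · rw [hval _ (by simp; omega)]
        simp only [Option.some.injEq, Prod.mk.injEq, true_and]
        exact Fin.ext (by simp; omega)
      · rw [hval _ (by simp; omega)]
        simp only [Option.some.injEq, Prod.mk.injEq, true_and]
        exact Fin.ext (by simp)
      · rw [wall_adj]
        exact Or.inl ⟨rfl, Or.inl (by simp; omega)⟩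
    · -- same row, `m = m' + 1`
      subst hii'
      have hm : 2 * (m : ℕ) ≤ r := by have := m.isLt; omega
      refine ⟨(i, ⟨2 * (m : ℕ), by omega⟩), (i, ⟨2 * (m' : ℕ) + 1, by omega⟩), ?_, ?_, ?_⟩
      · rw [hval _ (by simp; omega)]
        simp only [Option.some.injEq, Prod.mk.injEq, true_and]
        exact Fin.ext (by simp)
      · rw [hval _ (by simp; omega)]
        simp only [Option.some.injEq, Prod.mk.injEq, true_and]
        exact Fin.ext (by simp; omega)
      · rw [wall_adj]
        exact Or.inl ⟨rfl, Or.inr (by simp; omega)⟩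
    · -- same pair, `i' = i + 1`: the column of the pair with `i + j` even
      subst hmm'
      have hm : 2 * (m : ℕ) + 1 ≤ r := by have := m.isLt; omega
      refine ⟨(i, ⟨2 * (m : ℕ) + (i : ℕ) % 2, by omega⟩), (i', ⟨2 * (m : ℕ) + (i : ℕ) % 2, by omega⟩),
        ?_, ?_, ?_⟩
      · rw [hval _ (by simp; omega)]
        simp only [Option.some.injEq, Prod.mk.injEq, true_and]
        exact Fin.ext (by simp; omega)
      · rw [hval _ (by simp; omega)]
        simp only [Option.some.injEq, Prod.mk.injEq, true_and]
        exact Fin.ext (by simp; omega)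
      · rw [wall_adj]
        exact Or.inr ⟨rfl, Or.inl ⟨hii', by simp; omega⟩⟩
    · -- same pair, `i = i' + 1`
      subst hmm'
      have hm : 2 * (m : ℕ) + 1 ≤ r := by have := m.isLt; omega
      refine ⟨(i, ⟨2 * (m : ℕ) + (i' : ℕ) % 2, by omega⟩), (i', ⟨2 * (m : ℕ) + (i' : ℕ) % 2, by omega⟩),
        ?_, ?_, ?_⟩
      · rw [hval _ (by simp; omega)]
        simp only [Option.some.injEq, Prod.mk.injEq, true_and]
        exact Fin.ext (by simp; omega)
      · rw [hval _ (by simp; omega)]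
        simp only [Option.some.injEq, Prod.mk.injEq, true_and]
        exact Fin.ext (by simp; omega)
      · rw [wall_adj]
        exact Or.inr ⟨rfl, Or.inr ⟨hii', by simp; omega⟩⟩

/-- **The tree-width of the wall**: `b ≤ tw(wall r)` whenever `2b + 1 ≤ r` (so `tw(W_r) ≥ ⌊(r-1)/2⌋`), from the grid
(`min_le_treewidth_grid`) through the minor `grid r b ≼ₘ wall r` and minor-monotonicity (`treewidth_le_of_isMinor`).
[cite: BondyMurty2008, §10.5; Diestel2010, §12.3] -/
theorem le_treewidth_wall {r b : ℕ} (hb : 2 * b + 1 ≤ r) : b ≤ treewidth (wall r) := by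
  have h1 : b ≤ treewidth (grid r b) := by
    have := Literature.Combinatorics.SimpleGraph.min_le_treewidth_grid r b
    rwa [min_eq_right (by omega)] at this
  exact h1.trans (treewidth_le_of_isMinor (grid_isMinor_wall hb))

end Summit.ValiantsHypothesis.ValiantsHypothesis.Theorems.CFIHomMonotone

end
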